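import Literature.MathematicalPhysics.QuantumLattice.DWaveSourceNNNHoppingFlatTwistLocalDensity
import Literature.MathematicalPhysics.QuantumLattice.DWaveSourceNNNHoppingWindowHamiltonian
import Literature.MathematicalPhysics.QuantumLattice.HubbardNNNHoppingPlaquetteFluxTranslation
import Literature.MathematicalPhysics.QuantumLattice.PhaseGaugeNaturality
import HarnessLib

/-!
# The flat-twisted pair-sourced `t–t'` WINDOW Hamiltonian; locality of the twisted torus Hamiltonian seen from an
# inner region; translation and `S^z` invariance of the twisted torus

Topic `Literature/MathematicalPhysics/QuantumLattice` (namespace = path; family `hubbard`). Companion of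
`DWaveSourceNNNHoppingWindowHamiltonian.lean` (the untwisted pair-sourced `t–t'` window Hamiltonian
`pairSourceWindowHamiltonianTT' g Λ' tp U μ h` and its locality `dWaveSourceTorusTT'_sub_fermionEmbed_mem_carEvenSubalgebra`),
of `DWaveSourceNNNHoppingFlatTwist.lean` / `DWaveSourceNNNHoppingFlatTwistLocalDensity.lean` (the T8 torus
`dWaveSourceTorusTT'Twist L tp U μ h n`, the window twist phase `windowTwistPhase κ`, the periodisation identity at
trivial holonomy) and of `PhaseGaugeNaturality.lean` (`W_G Γ(φ)(Z) W_Gᴴ = Γ(φ)(W_{G∘φ} Z W_{G∘φ}ᴴ)`). It is the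
structural input of the window-certificate SOUNDNESS theorem for the twisted torus
(`DWaveSourceNNNHoppingFlatTwistWindowCertificate.lean`): the producer, on the Lean side, of certified LOWER bounds
`c·L² ≤ E₀(dWaveSourceTorusTT'Twist L … n)` — the `lo` slot of the Hubbard cuprate cell's rows T8/T8′.

* `pairSourceWindowHamiltonianTT'Twist Λ' tp U μ h κ = H^{src,tt'}_{Λ'} + (W_ĝ H^{tt'}_{Λ'} W_ĝᴴ − H^{tt'}_{Λ'})` — the
  untwisted sourced window Hamiltonian with its hopping–interaction part `H^{tt'}_{Λ'}` (the local Hamiltonian of the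
  `t–t'–U` interaction) conjugated by the window gauge `W_ĝ = phaseGauge (windowTwistPhase κ)`: every hop `c†_x c_y`
  inside `Λ'` carries `κ^{x−y}`, the interaction, `−μN_{Λ'}` and the source are untwisted (the only definition).
* `phaseGauge_conj_mem_carEvenSubalgebra` — `Ad(W_g)` preserves every even CAR subalgebra (generators go to scalar
  multiples of themselves).
* `dWaveSourceTorusTT'Twist_sub_fermionEmbed_eq` (`L ≥ 3`, `χ_L(n_i) = κ_i`): `Twist_L − Γ(H^{tw}_{Λ'})` = the
  untwisted defect + the torus-boost conjugate of the hopping defect − the hopping defect (naturality moves the window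
  gauge to the boost `W_n`, `conj_hubbardTorusTT'Twist` moves the twisted hopping torus to the untwisted one); each piece
  is EVEN and supported OFF `Γ(𝔄_Λ)` (`thicken Λ 1 ⊆ Λ'`, the window fitting), hence
  **`dWaveSourceTorusTT'Twist_commutator_fermionEmbed`**: `[Twist_L, Γ(B)] = Γ([H^{tw}_{Λ'}, B])` for `B ∈ 𝔄_Λ` — the
  commutator null terms of a twisted window certificate are exact identities on every large torus of the ladder.
* `relabel_translate_dWaveSourceTorusTT'Twist`, `fockTranslate_mul_dWaveSourceTorusTT'Twist` (a FLAT twist is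
  translation invariant), `spinZ_mul_dWaveSourceTorusTT'Twist` (the twisted hopping conserves `N↑, N↓`; the source is
  a singlet).

HONEST SCOPE: operator identities on finite tori and windows; no number, nothing about superconductivity. Everything
PROVED except the one `def`.

## References
* X. Han, arXiv:2006.06002, §3 (window / reduced-density-matrix certificates: `F[[H, O]] = 0`). [cite: Han2020Bootstrap, §3]
* O. Bratteli, D. W. Robinson, *Operator Algebras and Quantum Statistical Mechanics 2* (1997), §5.2.2, §6.2.1
  (local even CAR algebras; commutation at disjoint supports). [cite: BratteliRobinsonII1997, §5.2.2]
* H. Watanabe, J. Stat. Phys. 177 (2019) 717, §2.2.1 (flat twists are pure gauges at trivial holonomy).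
  [cite: Watanabe2019, §2.2.1]
* T. Koma, H. Tasaki, J. Stat. Phys. 76 (1994) 745, §1 (pair source). [cite: KomaTasaki1994, §1]
-/

noncomputable section

namespace Literature.MathematicalPhysics.QuantumLattice

open _root_.Matrix Finset HubbardWave0 Literature.Probability.LatticeModels
open scoped ComplexConjugate

/-! ### `Ad(W_g)` preserves the even CAR subalgebras -/

section GaugeEven

variable {Λ : Type*} [LinearOrder Λ] [Fintype Λ]

/-- Each Jordan–Wigner letter is an eigenvector of `Ad(W_g)`: `W_g (letterOp l) W_gᴴ = c • letterOp l` for a unimodular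
scalar `c`. [cite: BratteliRobinsonII1997, §5.2.2] -/
theorem exists_phaseGauge_mul_letterOp_mul_conjTranspose_eq_smul (g : Λ → Circle) (l : JWLetter (Orb Λ)) :
    ∃ c : ℂ, phaseGauge g * letterOp l * (phaseGauge g)ᴴ = c • letterOp l := by
  obtain ⟨o, b⟩ := l
  cases b
  · refine ⟨conj (g (ofLex o).1 : ℂ), ?_⟩
    have e : letterOp (o, false) = annihilation (orb (ofLex o).1 (ofLex o).2) := by rw [letterOp]; rfl
    rw [e, phaseGauge_mul_annihilation_mul_conjTranspose]
  · refine ⟨(g (ofLex o).1 : ℂ), ?_⟩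
    have e : letterOp (o, true) = creation (orb (ofLex o).1 (ofLex o).2) := by rw [letterOp]; rfl
    rw [e, phaseGauge_mul_creation_mul_conjTranspose]

/-- **`Ad(W_g)` preserves every even CAR subalgebra**: `A ∈ 𝔄^{even}(S) ⇒ W_g A W_gᴴ ∈ 𝔄^{even}(S)` (each generator
`letterOp l · letterOp l'` goes to a scalar multiple of itself; `Ad(W_g)` is an algebra map).
[cite: BratteliRobinsonII1997, §5.2.2] -/
theorem phaseGauge_conj_mem_carEvenSubalgebra (g : Λ → Circle) {S : Finset (Orb Λ)}
    {A : Matrix (Finset (Orb Λ)) (Finset (Orb Λ)) ℂ} (hA : A ∈ carEvenSubalgebra S) :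
    phaseGauge g * A * (phaseGauge g)ᴴ ∈ carEvenSubalgebra S := by
  induction hA using Algebra.adjoin_induction with
  | mem x hx =>
    obtain ⟨l, l', hl, hl', rfl⟩ := hx
    obtain ⟨c, hc⟩ := exists_phaseGauge_mul_letterOp_mul_conjTranspose_eq_smul g l
    obtain ⟨c', hc'⟩ := exists_phaseGauge_mul_letterOp_mul_conjTranspose_eq_smul g l'
    have hmem : letterOp l * letterOp l' ∈ carEvenSubalgebra S := Algebra.subset_adjoin ⟨l, l', hl, hl', rfl⟩
    rw [phaseGauge_mul_mul_mul_conjTranspose, hc, hc', Matrix.smul_mul, Matrix.mul_smul, smul_smul]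
    exact Subalgebra.smul_mem _ hmem _
  | algebraMap r =>
    rw [Algebra.algebraMap_eq_smul_one, Matrix.mul_smul, Matrix.mul_one, Matrix.smul_mul,
      phaseGauge_mul_conjTranspose_self]
    exact Subalgebra.smul_mem _ (Subalgebra.one_mem _) _
  | add x y _ _ hx hy =>
    rw [Matrix.mul_add, Matrix.add_mul]
    exact add_mem hx hy
  | mul x y _ _ hx hy =>
    rw [phaseGauge_mul_mul_mul_conjTranspose]
    exact mul_mem hx hy

end GaugeEven

/-! ### The twisted window Hamiltonian -/

section Window

/-- **The flat-twisted pair-sourced `t–t'` WINDOW Hamiltonian** of a finite window `Λ' ⊆ ℤ²`: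
`H^{tw}_{Λ'}(κ) = H^{src,tt'}_{Λ'} + (W_ĝ H^{tt'}_{Λ'} W_ĝᴴ − H^{tt'}_{Λ'})`, i.e. the sourced window Hamiltonian whose
hopping–interaction part `H^{tt'}_{Λ'} = (hubbardTTPrimeFermionInteraction 1 tp U).localHamiltonian Λ'` is conjugated
by the window gauge `W_ĝ`, `ĝ(y) = κ₀^{y₀} κ₁^{y₁}`: every hop `c†_x c_y` inside the window carries the bond phase
`κ^{x−y}`; `−μN_{Λ'}` and the `d`-wave source are untwisted. [cite: Han2020Bootstrap, §3] -/
def pairSourceWindowHamiltonianTT'Twist (Λ' : Finset (Site 2)) (tp U μ h : ℝ) (κ : Fin 2 → Circle) : FermionOp Λ' :=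
  pairSourceWindowHamiltonianTT' dWaveFormFactor Λ' tp U μ h +
    (phaseGauge (windowTwistPhase κ) * (hubbardTTPrimeFermionInteraction 1 tp U).localHamiltonian Λ' *
        (phaseGauge (windowTwistPhase κ))ᴴ -
      (hubbardTTPrimeFermionInteraction 1 tp U).localHamiltonian Λ')

/-- At `κ = 1` the twisted window Hamiltonian is the untwisted one. [cite: Han2020Bootstrap, §3] -/
theorem pairSourceWindowHamiltonianTT'Twist_one (Λ' : Finset (Site 2)) (tp U μ h : ℝ) :
    pairSourceWindowHamiltonianTT'Twist Λ' tp U μ h 1 = pairSourceWindowHamiltonianTT' dWaveFormFactor Λ' tp U μ h := by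
  have h1 : (windowTwistPhase (W := Λ') 1) = 1 := by
    funext y
    simp [windowTwistPhase]
  rw [pairSourceWindowHamiltonianTT'Twist, h1, phaseGauge_one, conjTranspose_one, Matrix.one_mul, Matrix.mul_one,
    sub_self, add_zero]

variable (L : ℕ) [NeZero L]

/-- **The window twist phase is the torus boost restricted along the site map** (trivial holonomy): if
`χ_L(n_i) = κ_i` then `(u ↦ χ(n·u)) ∘ (y ↦ y mod L) = windowTwistPhase κ` on the ordered sites of any window.
[cite: Watanabe2019, §2.2.1] -/
theorem boostPhase2_comp_toTorusEmb_eq_windowTwistPhase {Λ' : Finset (Site 2)} {n : Fin 2 → ZMod L}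
    {κ : Fin 2 → Circle} (hκ : ∀ i, ZMod.toCircle (n i) = κ i) (hInj' : Set.InjOn (Torus.proj (d := 2) L) ↑Λ') :
    (fun u : FermionTorus 2 L => boostPhase2 L n u.toTorusSite) ∘ (PolySite.toTorusEmb L hInj') =
      windowTwistPhase (W := Λ') κ := by
  funext y
  rw [Function.comp_apply, PolySite.toTorusEmb_apply, FermionTorus.toTorusSite_ofTorusSite,
    boostPhase2_proj L n κ hκ, windowTwistPhase]

/-- **The twisted hopping torus is the boost conjugate of the untwisted one** (`L ≥ 3`):
`hubbardTorusTT'Twist L tp U n = W_n (hubbardTorusTT' L 1 tp U) W_nᴴ` (`conj_hubbardTorusTT'Twist`, inverted).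
[cite: Watanabe2019, §2.2.1] -/
theorem hubbardTorusTT'Twist_eq_conj (hL : 3 ≤ L) (tp U : ℝ) (n : Fin 2 → ZMod L) :
    hubbardTorusTT'Twist L tp U n =
      phaseGauge (fun u : FermionTorus 2 L => boostPhase2 L n u.toTorusSite) * hubbardTorusTT' L 1 tp U *
        (phaseGauge fun u : FermionTorus 2 L => boostPhase2 L n u.toTorusSite)ᴴ := by
  rw [← conj_hubbardTorusTT'Twist L hL tp U n, phaseGauge_mul_conj_mul_conjTranspose]

/-- The twisted sourced torus is the untwisted one plus the twist defect of the hopping: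
`Twist_L(h) = A_L(h) + (H^{tt'}_{twist} − H^{tt'})`. [cite: KomaTasaki1994, §1] -/
theorem dWaveSourceTorusTT'Twist_eq_add_sub (tp U μ h : ℝ) (n : Fin 2 → ZMod L) :
    dWaveSourceTorusTT'Twist L tp U μ h n =
      dWaveSourceTorusTT' L tp U μ h + (hubbardTorusTT'Twist L tp U n - hubbardTorusTT' L 1 tp U) := by
  rw [dWaveSourceTorusTT'Twist, dWaveSourceTorusTT']
  abel

/-! ### Locality of the twisted torus Hamiltonian seen from an inner region -/

/-- The twisted defect decomposes into the untwisted defect plus the boost conjugate of the `μ = h = 0` defect minus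
that defect (`L ≥ 3`, `χ_L(n_i) = κ_i`): naturality moves the window gauge to the boost and
`H^{tt'}_{twist} = W_n H^{tt'} W_nᴴ`. [cite: Watanabe2019, §2.2.1] -/
theorem dWaveSourceTorusTT'Twist_sub_fermionEmbed_eq (hL : 3 ≤ L) {Λ' : Finset (Site 2)}
    (hInj' : Set.InjOn (Torus.proj (d := 2) L) ↑Λ') (tp U μ h : ℝ)
    {n : Fin 2 → ZMod L} {κ : Fin 2 → Circle} (hκ : ∀ i, ZMod.toCircle (n i) = κ i) :
    dWaveSourceTorusTT'Twist L tp U μ h n -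
        fermionEmbed (PolySite.toTorusEmb L hInj') (pairSourceWindowHamiltonianTT'Twist Λ' tp U μ h κ) =
      (dWaveSourceTorusTT' L tp U μ h -
          fermionEmbed (PolySite.toTorusEmb L hInj') (pairSourceWindowHamiltonianTT' dWaveFormFactor Λ' tp U μ h)) +
        (phaseGauge (fun u : FermionTorus 2 L => boostPhase2 L n u.toTorusSite) *
            (hubbardTorusTT' L 1 tp U -
              fermionEmbed (PolySite.toTorusEmb L hInj') ((hubbardTTPrimeFermionInteraction 1 tp U).localHamiltonian Λ')) *
            (phaseGauge fun u : FermionTorus 2 L => boostPhase2 L n u.toTorusSite)ᴴ -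
          (hubbardTorusTT' L 1 tp U -
            fermionEmbed (PolySite.toTorusEmb L hInj') ((hubbardTTPrimeFermionInteraction 1 tp U).localHamiltonian Λ'))) := by
  -- naturality: the embedded rotated local Hamiltonian is the boost conjugate of the embedded one
  have hnat : fermionEmbed (PolySite.toTorusEmb L hInj')
      (phaseGauge (windowTwistPhase κ) * (hubbardTTPrimeFermionInteraction 1 tp U).localHamiltonian Λ' *
        (phaseGauge (windowTwistPhase κ))ᴴ) =
      phaseGauge (fun u : FermionTorus 2 L => boostPhase2 L n u.toTorusSite) *
        fermionEmbed (PolySite.toTorusEmb L hInj') ((hubbardTTPrimeFermionInteraction 1 tp U).localHamiltonian Λ') *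
        (phaseGauge fun u : FermionTorus 2 L => boostPhase2 L n u.toTorusSite)ᴴ := by
    rw [← boostPhase2_comp_toTorusEmb_eq_windowTwistPhase L hκ hInj', ← phaseGauge_mul_fermionEmbed_mul_conjTranspose]
  rw [dWaveSourceTorusTT'Twist_eq_add_sub, hubbardTorusTT'Twist_eq_conj L hL, pairSourceWindowHamiltonianTT'Twist,
    fermionEmbed_add, fermionEmbed_sub, hnat, Matrix.mul_sub, Matrix.sub_mul]
  abel

/-- **Locality of the twisted sourced torus Hamiltonian seen from an inner region**: for `L ≥ 3`, a twist `n` with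
`χ_L(n_i) = κ_i`, `Λ ⊆ Λ'` with `thicken Λ 1 ⊆ Λ'`, `x ↦ x mod L` injective on `thicken Λ' 1`, and every `B ∈ 𝔄_Λ`:
`[Twist_L, Γ(B)] = Γ([H^{tw}_{Λ'}, B])`. Route: `Twist_L − Γ(H^{tw}_{Λ'})` is the untwisted defect plus the boost
conjugate of the hopping defect minus the hopping defect (`dWaveSourceTorusTT'Twist_sub_fermionEmbed_eq`); each of
the three is even and supported off `Γ(𝔄_Λ)` (the untwisted locality statements; `Ad(W_n)` preserves that algebra),
hence commutes with `Γ(B)`. The commutator null terms of a twisted window certificate are exact identities on every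
large torus of the ladder. [cite: Han2020Bootstrap, §3] -/
theorem dWaveSourceTorusTT'Twist_commutator_fermionEmbed (hL : 3 ≤ L) {Λ Λ' : Finset (Site 2)} (hΛ : Λ ⊆ Λ')
    (h8 : thicken Λ 1 ⊆ Λ') (hInj : Set.InjOn (Torus.proj (d := 2) L) ↑(thicken Λ' 1)) (tp U μ h : ℝ)
    {n : Fin 2 → ZMod L} {κ : Fin 2 → Circle} (hκ : ∀ i, ZMod.toCircle (n i) = κ i) (A : FermionOp Λ) :
    dWaveSourceTorusTT'Twist L tp U μ h n *
          fermionEmbed (PolySite.toTorusEmb L (hInj.mono (by exact_mod_cast subset_thicken Λ' 1)))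
            (fermionEmbed (PolySite.incl hΛ) A) -
        fermionEmbed (PolySite.toTorusEmb L (hInj.mono (by exact_mod_cast subset_thicken Λ' 1)))
            (fermionEmbed (PolySite.incl hΛ) A) * dWaveSourceTorusTT'Twist L tp U μ h n =
      fermionEmbed (PolySite.toTorusEmb L (hInj.mono (by exact_mod_cast subset_thicken Λ' 1)))
        (pairSourceWindowHamiltonianTT'Twist Λ' tp U μ h κ * fermionEmbed (PolySite.incl hΛ) A -
          fermionEmbed (PolySite.incl hΛ) A * pairSourceWindowHamiltonianTT'Twist Λ' tp U μ h κ) := by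
  have hInj' : Set.InjOn (Torus.proj (d := 2) L) ↑Λ' := hInj.mono (by exact_mod_cast subset_thicken Λ' 1)
  -- the three even, far-from-`Λ` pieces
  have h1 := dWaveSourceTorusTT'_sub_fermionEmbed_mem_carEvenSubalgebra L hΛ h8 hInj tp U μ h
  have h0 := hubbardTorusTT'_sub_fermionEmbed_localHamiltonian_mem_carEvenSubalgebra (L := L) (t := 1) (t' := tp) (U := U)
    hΛ h8 hInj
  have h0' := phaseGauge_conj_mem_carEvenSubalgebra (fun u : FermionTorus 2 L => boostPhase2 L n u.toTorusSite) h0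
  -- each commutes with the embedded `B`
  have hY := fermionEmbed_mem_carSubalgebra ((PolySite.incl hΛ).trans (PolySite.toTorusEmb L hInj')) A
  have hdisj := disjoint_compl_left_iff.2 (orbs_map_incl_trans_toTorusEmb_subset L hΛ hInj')
  have hc1 := commute_of_mem_carEvenSubalgebra h1 hY hdisj
  have hc0 := commute_of_mem_carEvenSubalgebra h0 hY hdisj
  have hc0' := commute_of_mem_carEvenSubalgebra h0' hY hdisj
  have hc : Commute (dWaveSourceTorusTT'Twist L tp U μ h n -
      fermionEmbed (PolySite.toTorusEmb L hInj') (pairSourceWindowHamiltonianTT'Twist Λ' tp U μ h κ))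
      (fermionEmbed (PolySite.toTorusEmb L hInj') (fermionEmbed (PolySite.incl hΛ) A)) := by
    rw [fermionEmbed_fermionEmbed, dWaveSourceTorusTT'Twist_sub_fermionEmbed_eq L hL hInj' tp U μ h hκ]
    exact hc1.add_left (hc0'.sub_left hc0)
  rw [Commute, SemiconjBy, sub_mul, mul_sub, sub_eq_sub_iff_sub_eq_sub] at hc
  rw [fermionEmbed_sub, fermionEmbed_mul, fermionEmbed_mul]
  exact hc

/-! ### Translation and `S^z` invariance of the twisted torus -/

/-- A FLAT twist is translation invariant: `Γ_{τ_v}(H^{tt'}_{twist n}) = H^{tt'}_{twist n}`. [cite: Watanabe2019, §2.2.1] -/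
theorem relabel_translate_hubbardTorusTT'Twist (v : TorusSite 2 L) (tp U : ℝ) (n : Fin 2 → ZMod L) :
    relabel (Orb.translate v) (hubbardTorusTT'Twist L tp U n) = hubbardTorusTT'Twist L tp U n := by
  rw [hubbardTorusTT'Twist, relabel_add, relabel_smul, relabel_translate_magneticHubbardTorus,
    relabel_translate_diagPeierlsHopping]
  rfl

/-- The twisted sourced torus is translation invariant: `Γ_{τ_v}(Twist_L) = Twist_L`. [cite: Watanabe2019, §2.2.1] -/
theorem relabel_translate_dWaveSourceTorusTT'Twist (v : TorusSite 2 L) (tp U μ h : ℝ) (n : Fin 2 → ZMod L) :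
    relabel (Orb.translate v) (dWaveSourceTorusTT'Twist L tp U μ h n) = dWaveSourceTorusTT'Twist L tp U μ h n := by
  rw [dWaveSourceTorusTT'Twist, relabel_sub, relabel_sub, relabel_smul, relabel_smul, relabel_add,
    relabel_conjTranspose, relabel_translate_hubbardTorusTT'Twist, relabel_translate_pairField, Orb.translate,
    relabel_mapEquiv_totalNumber]

/-- **Translation invariance**: `U_v Twist_L = Twist_L U_v`. [cite: Watanabe2019, §2.2.1] -/
theorem fockTranslate_mul_dWaveSourceTorusTT'Twist (v : TorusSite 2 L) (tp U μ h : ℝ) (n : Fin 2 → ZMod L) :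
    (fockTranslate v).val * dWaveSourceTorusTT'Twist L tp U μ h n =
      dWaveSourceTorusTT'Twist L tp U μ h n * (fockTranslate v).val :=
  (fockRelabel_commute_of_relabel_eq _ (relabel_translate_dWaveSourceTorusTT'Twist L v tp U μ h n)).eq

/-- The twisted hopping torus commutes with `S^z` (it conserves `N↑` and `N↓`). [cite: Watanabe2019, §2.2.1] -/
theorem spinZ_commute_hubbardTorusTT'Twist (tp U : ℝ) (n : Fin 2 → ZMod L) :
    Commute HubbardWave0.spinZ (hubbardTorusTT'Twist L tp U n) := by
  have h0 := (preservesSectors_hubbardTorusTT'Twist L tp U n).commute_diagonal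
    fun a b : ℕ => (1 / 2 : ℂ) * ((a : ℂ) - (b : ℂ))
  rw [LiebThm1.spinZ_eq_diagonal]
  -- the two `diagonal`s may carry different (propositionally equal) `DecidableEq` instances
  convert h0.symm using 2

/-- **`S^z` invariance**: `S^z · Twist_L = Twist_L · S^z` (twisted hopping conserves the spin; `μN` and the singlet
source commute with `S^z` as in the untwisted torus). [cite: KomaTasaki1994, §1] -/
theorem spinZ_mul_dWaveSourceTorusTT'Twist (tp U μ h : ℝ) (n : Fin 2 → ZMod L) :
    HubbardWave0.spinZ * dWaveSourceTorusTT'Twist L tp U μ h n = dWaveSourceTorusTT'Twist L tp U μ h n * HubbardWave0.spinZ := by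
  have h1 : Commute HubbardWave0.spinZ (dWaveSourceTorusTT' L tp U μ h) := spinZ_mul_dWaveSourceTorusTT' L tp U μ h
  have h2 : Commute HubbardWave0.spinZ (hubbardTorusTT' L 1 tp U) := (hubbardTorusTT'_commute_spinZ L 1 tp U).symm
  have h3 := spinZ_commute_hubbardTorusTT'Twist L tp U n
  rw [dWaveSourceTorusTT'Twist_eq_add_sub]
  exact (h1.add_right (h3.sub_right h2)).eq

end Window

end Literature.MathematicalPhysics.QuantumLattice

end
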